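import Literature.NumberTheory.Rogawski1990.ArchOrbFamGExtFaceJetBounds   -- ★ p851037∕p851101 (LH3-p02 (g4)) (B2): §1 generic Leibniz∕pull-back jet lemmas, `archERhoG_ne_zero_of_fintype`; brings `orbFamGExt`, `InRegG`, `hcThird`
import HarnessLib

/-!
# (I₁) AT A MULTI-WALL POINT: near ANY wall point of the fundamental cube `InRegG` is the complement of finitely many LITERAL walls; binder-form local jet bounds
# of `orbFamGExt` from a model of the twisted family off those walls (Varadarajan 1977 I §1.12; Bouaziz 1994 §3.1–3.2; Shelstad 1979 §4)

Topic `NumberTheory/Rogawski1990`; namespace `Literature.NumberTheory.Rogawski1990`.  THEOREMS ONLY (no `def`, no instance, no notation, no axiom, no named fact,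
no `sorry`).  Cell `pub/hodgecm-mathlib`, crux H413 (`stmt-HodgeConjecture-24833`), F0∕P3c line LH3 (closer stub `stub_N9`, DIRECT ROAD), LETTER L1 clause (I₁) of
★ `ArchHcSmoothOneSided` for the genuine family `orbFamGExt L α ν′ a′`: brick **(X1) «MULTI-WALL NEIGHBOURHOOD + BINDER HEAD»** of the cross-place-corner road
(X1)–(X3) (organ O-L1c-X′ of leaf `F0_P3c_StubN9Direct` v5; (I₁) spec-owner LH7-p04 (g4) «= (X1) now» 2026-09-02T10:48:47Z on ★ (I₁-asm) `ArchHCSmoothBoundedStrata` v2),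
seat F0P3a-p02 (g21).  Count-neutral.

THE MATHEMATICS.  ★ `smoothBounded_orbFamGExt_of_forall_wall` (B1) reduces (I₁) to LOCAL bounds at the wall points `x` of the fundamental cube (`x w i ∈ [0, 2π)` at the
compact places), where every eigenvalue coincidence is a literal equality `x w i = x w j`.  At such a point — a face, a cross-place corner, or even a scalar corner — the
set `InRegG s S′` coincides, on a neighbourhood `U ∋ x`, with the complement of the finitely many LITERAL noncompact walls through `x`:
  `c ∈ InRegG s S′ ↔ ∀ (w ∉ S′) (i ≠ j), s w i ≠ s w j → x w i = x w j → c w i ≠ c w j`   (§1, `exists_nhds_forall_mem_inRegG_iff_of_multiWall`)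
— the noncompact pairs that do NOT coincide at `x` stay apart near `x` (open condition), and a pair that coincides at `x` is read through `|c w i − c w j| < π`, where
`e^{i c_{w i}} ≠ e^{i c_{w j}} ↔ c w i ≠ c w j`.  This is the multi-wall twin of ★ `exists_nhds_forall_mem_inRegG_iff_of_oneWall` (LH3-p02), with no hypothesis on the
other places at all.  §2 is the corresponding BINDER HEAD, the twin of ★ `exists_nhds_bddAbove_norm_iteratedFDeriv_orbFamGExt_of_faceModel_oneWall`: if OFF those walls,
near `x`, the twisted family `e^{ρ}_{S′} · orbFamGExt ν′ a′ S′` equals a model `H` of class `Cⁿ` there with every jet of order `≤ n` bounded near `x` off the walls, then the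
`n`-jet of `orbFamGExt ν′ a′ S′` is bounded on `U′ ∩ InRegG (slotSign α) S′` for a neighbourhood `U′` of `x` — the `hwall` binder of (B1) at `x` VERBATIM (Leibniz against the
smooth unit `(e^{ρ})⁻¹`, ★ (B2) §1).  §3 reads the model in product coordinates `H = H₂ ∘ A` (continuous linear chart `A`, e.g. the normal coordinates of the corner walls ×
the transversal rest) and gives the `∀ n` forms; §4 is the socket adapter for the (X′) stratum of ★ `wall_point_trichotomy` (cube hypothesis + `cexp`-coincidences ⇒ the
literal-wall data of §1–§3).  At a CROSS-PLACE CORNER (faces at `w₁ ≠ w₂`, no scalar corner) the model is supplied by the two-block descent box (X2) and its jet bounds by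
the nested `ℓ^∞`-family readers (X3); this file is the bookkeeping layer only and claims none of that analysis.
HONEST LABEL: bookkeeping (no analysis); the compact-SCALAR corners (organ O-L1d «HC-CENTRAL») are PRINT; HC_CM is proved only modulo the 7 printed citations (2 remaining:
hLiu418 = `stmt-HodgeConjecture-24832`, h413 = `stmt-HodgeConjecture-24833`) until rung 0 closes; this file moves no row of the books.

## References
* [Varadarajan1977] V. S. Varadarajan, *Harmonic Analysis on Real Reductive Groups*, LNM 576 (1977), Part I §1.12 (`'F_f`: bounded derivatives on `T_{in-reg}`), Part I §3.
* [Bouaziz1994IntegralesOrbitales] A. Bouaziz, *Intégrales orbitales sur les groupes de Lie réductifs*, Ann. Sci. ÉNS 27 (1994), §3.1 (I₁)–(I₂) p. 579, §3.2 p. 580, §6.2 p. 591.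
* [Shelstad1979] D. Shelstad, *Characters and inner forms of a quasi-split group over ℝ*, Compositio Math. 39 (1979), §4 pp. 22–25.
* [HormanderALPDO1] L. Hörmander, *The Analysis of Linear Partial Differential Operators I*, 2nd ed. (1990), §1.1 (1.1.8)–(1.1.9).
-/

set_option autoImplicit false

noncomputable section

open Set Filter Topology Function MeasureTheory NumberField NumberField.InfinitePlace
open scoped ContDiff MatrixGroups Matrix Classical

namespace Literature.NumberTheory.Rogawski1990

open Literature.NumberTheory.Automorphic Literature.NumberTheory.Automorphic.UnitaryGroup Literature.NumberTheory.Automorphic.ArchCartan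

/-! ## §1 Near a wall point with literal coincidences, `InRegG` is the complement of the literal noncompact walls through the point -/

section MultiWall

variable {W : Type*} [Fintype W]

/-- **The off-wall set of a point is open**: `{c | ∀ (w ∉ S′) (i ≠ j), s w i ≠ s w j → x w i = x w j → c w i ≠ c w j}` — finitely many open conditions.
[cite: Bouaziz1994IntegralesOrbitales, §6.2 p. 591] -/
theorem isOpen_setOf_forall_multiWall_ne (s : W → Fin 3 → SignType) (S' : Finset W) (x : W → Fin 3 → ℝ) :
    IsOpen {c : W → Fin 3 → ℝ | ∀ w, w ∉ S' → ∀ i j : Fin 3, i ≠ j → s w i ≠ s w j → x w i = x w j → c w i ≠ c w j} := by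
  have h : {c : W → Fin 3 → ℝ | ∀ w, w ∉ S' → ∀ i j : Fin 3, i ≠ j → s w i ≠ s w j → x w i = x w j → c w i ≠ c w j} =
      ⋂ w : W, ⋂ i : Fin 3, ⋂ j : Fin 3, {c | w ∉ S' → i ≠ j → s w i ≠ s w j → x w i = x w j → c w i ≠ c w j} := by
    ext c; simp only [mem_setOf_eq, mem_iInter]
    exact ⟨fun h' w i j hw => h' w hw i j, fun h' w hw i j => h' w i j hw⟩
  rw [h]
  refine isOpen_iInter_of_finite fun w => isOpen_iInter_of_finite fun i => isOpen_iInter_of_finite fun j => ?_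
  by_cases hP : w ∉ S' ∧ i ≠ j ∧ s w i ≠ s w j ∧ x w i = x w j
  · have : {c : W → Fin 3 → ℝ | w ∉ S' → i ≠ j → s w i ≠ s w j → x w i = x w j → c w i ≠ c w j} = {c | c w i ≠ c w j} := by
      ext c; simp only [mem_setOf_eq]; exact ⟨fun h' => h' hP.1 hP.2.1 hP.2.2.1 hP.2.2.2, fun h' _ _ _ _ => h'⟩
    rw [this]
    exact isOpen_ne_fun ((continuous_apply i).comp (continuous_apply w)) ((continuous_apply j).comp (continuous_apply w))
  · have : {c : W → Fin 3 → ℝ | w ∉ S' → i ≠ j → s w i ≠ s w j → x w i = x w j → c w i ≠ c w j} = univ := by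
      ext c; simp only [mem_setOf_eq, mem_univ, iff_true]; exact fun h1 h2 h3 h4 => (hP ⟨h1, h2, h3, h4⟩).elim
    rw [this]
    exact isOpen_univ

/-- **NEAR A WALL POINT WITH LITERAL COINCIDENCES, `InRegG s S′` IS THE COMPLEMENT OF THE LITERAL NONCOMPACT WALLS THROUGH IT.**  At `x` such that every coincident
noncompact pair is a LITERAL coincidence (`e^{i x_{w i}} = e^{i x_{w j}} → x w i = x w j` for `w ∉ S′`, `i ≠ j`, `s w i ≠ s w j` — automatic in the fundamental cube),
there is an open `U ∋ x` on which `c ∈ InRegG s S′ ↔ ∀ (w ∉ S′) (i ≠ j), s w i ≠ s w j → x w i = x w j → c w i ≠ c w j`, and on which, for every such coincident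
pair, `e^{i c_{w i}} ≠ e^{i c_{w j}} ↔ c w i ≠ c w j`.  No hypothesis at the other places or pairs (compact coincidences, split coordinates, several corner places, even a
scalar corner are all allowed): the multi-wall twin of ★ `exists_nhds_forall_mem_inRegG_iff_of_oneWall`.
[cite: Bouaziz1994IntegralesOrbitales, §3.2 p. 580; §6.2 p. 591] [cite: Shelstad1979, §4 pp. 22–23] -/
theorem exists_nhds_forall_mem_inRegG_iff_of_multiWall (s : W → Fin 3 → SignType) (S' : Finset W) {x : W → Fin 3 → ℝ}
    (hlit : ∀ w, w ∉ S' → ∀ i j : Fin 3, i ≠ j → s w i ≠ s w j → Circle.exp (x w i) = Circle.exp (x w j) → x w i = x w j) :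
    ∃ U : Set (W → Fin 3 → ℝ), IsOpen U ∧ x ∈ U ∧ ∀ c ∈ U,
      (c ∈ InRegG s S' ↔ ∀ w, w ∉ S' → ∀ i j : Fin 3, i ≠ j → s w i ≠ s w j → x w i = x w j → c w i ≠ c w j) ∧
      ∀ w, w ∉ S' → ∀ i j : Fin 3, i ≠ j → s w i ≠ s w j → x w i = x w j → (Circle.exp (c w i) ≠ Circle.exp (c w j) ↔ c w i ≠ c w j) := by
  -- the open conditions: coincident pairs stay `π`-close, non-coincident noncompact pairs stay apart
  set U₁ : Set (W → Fin 3 → ℝ) := ⋂ w : W, ⋂ i : Fin 3, ⋂ j : Fin 3,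
    {c | w ∉ S' → i ≠ j → s w i ≠ s w j → x w i = x w j → |c w i - c w j| < Real.pi} with hU₁
  set U₂ : Set (W → Fin 3 → ℝ) := ⋂ w : W, ⋂ i : Fin 3, ⋂ j : Fin 3,
    {c | w ∉ S' → i ≠ j → s w i ≠ s w j → Circle.exp (x w i) ≠ Circle.exp (x w j) → Circle.exp (c w i) ≠ Circle.exp (c w j)} with hU₂
  have hU₁o : IsOpen U₁ := by
    refine isOpen_iInter_of_finite fun w => isOpen_iInter_of_finite fun i => isOpen_iInter_of_finite fun j => ?_
    by_cases hP : w ∉ S' ∧ i ≠ j ∧ s w i ≠ s w j ∧ x w i = x w j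
    · have : {c : W → Fin 3 → ℝ | w ∉ S' → i ≠ j → s w i ≠ s w j → x w i = x w j → |c w i - c w j| < Real.pi} = {c | |c w i - c w j| < Real.pi} := by
        ext c; simp only [mem_setOf_eq]; exact ⟨fun h' => h' hP.1 hP.2.1 hP.2.2.1 hP.2.2.2, fun h' _ _ _ _ => h'⟩
      rw [this]
      have hdiff : Continuous fun c : W → Fin 3 → ℝ => c w i - c w j := by fun_prop
      exact isOpen_lt (continuous_abs.comp hdiff) continuous_const
    · have : {c : W → Fin 3 → ℝ | w ∉ S' → i ≠ j → s w i ≠ s w j → x w i = x w j → |c w i - c w j| < Real.pi} = univ := by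
        ext c; simp only [mem_setOf_eq, mem_univ, iff_true]; exact fun h1 h2 h3 h4 => (hP ⟨h1, h2, h3, h4⟩).elim
      rw [this]
      exact isOpen_univ
  have hU₂o : IsOpen U₂ := by
    refine isOpen_iInter_of_finite fun w => isOpen_iInter_of_finite fun i => isOpen_iInter_of_finite fun j => ?_
    by_cases hP : w ∉ S' ∧ i ≠ j ∧ s w i ≠ s w j ∧ Circle.exp (x w i) ≠ Circle.exp (x w j)
    · have : {c : W → Fin 3 → ℝ | w ∉ S' → i ≠ j → s w i ≠ s w j → Circle.exp (x w i) ≠ Circle.exp (x w j) → Circle.exp (c w i) ≠ Circle.exp (c w j)} =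
          {c | Circle.exp (c w i) ≠ Circle.exp (c w j)} := by
        ext c; simp only [mem_setOf_eq]; exact ⟨fun h' => h' hP.1 hP.2.1 hP.2.2.1 hP.2.2.2, fun h' _ _ _ _ => h'⟩
      rw [this]
      exact isOpen_ne_fun (continuous_circleExp_coord w i) (continuous_circleExp_coord w j)
    · have : {c : W → Fin 3 → ℝ | w ∉ S' → i ≠ j → s w i ≠ s w j → Circle.exp (x w i) ≠ Circle.exp (x w j) → Circle.exp (c w i) ≠ Circle.exp (c w j)} = univ := by
        ext c; simp only [mem_setOf_eq, mem_univ, iff_true]; exact fun h1 h2 h3 h4 => (hP ⟨h1, h2, h3, h4⟩).elim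
      rw [this]
      exact isOpen_univ
  have hxU₁ : x ∈ U₁ := by
    simp only [hU₁, mem_iInter, mem_setOf_eq]
    intro w i j _ _ _ hx
    rw [hx, sub_self, abs_zero]; exact Real.pi_pos
  have hxU₂ : x ∈ U₂ := by
    simp only [hU₂, mem_iInter, mem_setOf_eq]
    exact fun w i j _ _ _ hx => hx
  refine ⟨U₁ ∩ U₂, hU₁o.inter hU₂o, ⟨hxU₁, hxU₂⟩, fun c hc => ?_⟩
  have hc₁ : ∀ (w : W) (i j : Fin 3), w ∉ S' → i ≠ j → s w i ≠ s w j → x w i = x w j → |c w i - c w j| < Real.pi := by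
    have h := hc.1
    simp only [hU₁, mem_iInter, mem_setOf_eq] at h
    exact h
  have hc₂ : ∀ (w : W) (i j : Fin 3), w ∉ S' → i ≠ j → s w i ≠ s w j → Circle.exp (x w i) ≠ Circle.exp (x w j) →
      Circle.exp (c w i) ≠ Circle.exp (c w j) := by
    have h := hc.2
    simp only [hU₂, mem_iInter, mem_setOf_eq] at h
    exact h
  -- at a coincident pair, `e^{i c_i} ≠ e^{i c_j} ↔ c_i ≠ c_j` (they are `π`-close)
  have hiff : ∀ w, w ∉ S' → ∀ i j : Fin 3, i ≠ j → s w i ≠ s w j → x w i = x w j → (Circle.exp (c w i) ≠ Circle.exp (c w j) ↔ c w i ≠ c w j) := by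
    intro w hw i j hij hs hx
    refine ⟨fun h heq => h (by rw [heq]), fun hne => circleExp_ne_of_abs_sub_lt_two_pi hne ?_⟩
    have h1 : |c w i - c w j| < Real.pi := hc₁ w i j hw hij hs hx
    linarith [Real.pi_pos]
  refine ⟨⟨fun hcreg w hw i j hij hs hx => (hiff w hw i j hij hs hx).1 (hcreg w hw i j hij hs), fun hoff w hw i j hij hs => ?_⟩, hiff⟩
  by_cases hco : Circle.exp (x w i) = Circle.exp (x w j)
  · have hx : x w i = x w j := hlit w hw i j hij hs hco
    exact (hiff w hw i j hij hs hx).2 (hoff w hw i j hij hs hx)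
  · exact hc₂ w i j hw hij hs hco

omit [Fintype W] in
/-- **In the fundamental cube every eigenvalue coincidence is literal** (the `hlit` hypothesis of `exists_nhds_forall_mem_inRegG_iff_of_multiWall` from the cube condition of
★ `smoothBounded_orbFamGExt_of_forall_wall`): `e^{ia} = e^{ib}` with `a, b ∈ [0, 2π)` forces `a = b`. [cite: Shelstad1979, §4 p. 22] -/
theorem forall_literal_of_cube (s : W → Fin 3 → SignType) (S' : Finset W) {x : W → Fin 3 → ℝ}
    (hcube : ∀ w, w ∉ S' → ∀ i : Fin 3, x w i ∈ Ico 0 (2 * Real.pi)) :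
    ∀ w, w ∉ S' → ∀ i j : Fin 3, i ≠ j → s w i ≠ s w j → Circle.exp (x w i) = Circle.exp (x w j) → x w i = x w j := by
  intro w hw i j _ _ h
  have ha := hcube w hw i
  have hb := hcube w hw j
  by_contra hne
  refine circleExp_ne_of_abs_sub_lt_two_pi hne ?_ h
  rw [abs_sub_lt_iff]
  constructor <;> linarith [ha.1, ha.2, hb.1, hb.2]

end MultiWall

/-! ## §2 THE HEAD (binder form): local jet bounds of `orbFamGExt` at a multi-wall point from a `Cⁿ` model of the twisted family off the literal walls -/

section Head

variable (L : Type) [Field L] [NumberField L] [IsCMField L] (α : Fin 3 → L)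
  [MeasurableSpace ↥(arch (↥(maximalRealSubfield L)) L (IsCMField.complexConj L) 3 (Matrix.diagonal α))]
  [BorelSpace ↥(arch (↥(maximalRealSubfield L)) L (IsCMField.complexConj L) 3 (Matrix.diagonal α))]
  (ν' : Measure ↥(arch (↥(maximalRealSubfield L)) L (IsCMField.complexConj L) 3 (Matrix.diagonal α))) [IsFiniteMeasureOnCompacts ν'] [ν'.IsMulRightInvariant]
  (a' : ↥(arch (↥(maximalRealSubfield L)) L (IsCMField.complexConj L) 3 (Matrix.diagonal α)) → ℂ)
  (S' : Finset {w : InfinitePlace L // IsComplex w})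

/-- **(I₁) AT A MULTI-WALL POINT, BINDER FORM — LOCAL JET BOUNDS OF `orbFamGExt` FROM A MODEL OF THE TWISTED FAMILY OFF THE LITERAL WALLS.**  At a point `x` whose
noncompact coincidences are literal (`hlit`; e.g. a cross-place corner of the fundamental cube): if on a neighbourhood `U` of `x`, OFF the literal noncompact walls through `x`,
the twisted family `e^{ρ}_{S′} · orbFamGExt ν′ a′ S′` equals a model `H` (at a cross-place corner: the two-block descent identity (X2)), and `H` is `Cⁿ` off the walls with
every jet of order `≤ n` bounded near `x` off the walls ((X3): nested rank-one bounds read at `E′ = ℓ^∞`), THEN the `n`-jet of `orbFamGExt ν′ a′ S′` is bounded on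
`U′ ∩ InRegG (slotSign α) S′` for a neighbourhood `U′` of `x` — the `hwall` binder of ★ `smoothBounded_orbFamGExt_of_forall_wall` at `x`.  Proof: near `x`, `InRegG` is the
complement of the literal walls (§1); there `orbFamGExt = (e^{ρ})⁻¹ · H` with the smooth unit `(archERhoG S′)⁻¹`; Leibniz (★ (B2) §1).
[cite: Varadarajan1977, Part I §1.12] [cite: Bouaziz1994IntegralesOrbitales, §3.1 (I₁) p. 579; §3.2 p. 580] [cite: Shelstad1979, §4 pp. 22–24] -/
theorem exists_nhds_bddAbove_norm_iteratedFDeriv_orbFamGExt_of_multiWallModel {x : {w : InfinitePlace L // IsComplex w} → Fin 3 → ℝ}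
    (hlit : ∀ w, w ∉ S' → ∀ i j : Fin 3, i ≠ j → slotSign L α w i ≠ slotSign L α w j → Circle.exp (x w i) = Circle.exp (x w j) → x w i = x w j)
    {U : Set ({w : InfinitePlace L // IsComplex w} → Fin 3 → ℝ)} (hU : U ∈ 𝓝 x) (H : ({w : InfinitePlace L // IsComplex w} → Fin 3 → ℝ) → ℂ)
    (hfac : ∀ c ∈ U, (∀ w, w ∉ S' → ∀ i j : Fin 3, i ≠ j → slotSign L α w i ≠ slotSign L α w j → x w i = x w j → c w i ≠ c w j) →
      archERhoG S' c * orbFamGExt L α ν' a' S' c = H c)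
    (n : ℕ) (hHs : ContDiffOn ℝ n H (U ∩ {c | ∀ w, w ∉ S' → ∀ i j : Fin 3, i ≠ j → slotSign L α w i ≠ slotSign L α w j → x w i = x w j → c w i ≠ c w j}))
    (hHb : ∀ k ≤ n, ∃ U' ∈ 𝓝 x, BddAbove ((fun c => ‖iteratedFDeriv ℝ k H c‖) ''
      (U' ∩ {c | ∀ w, w ∉ S' → ∀ i j : Fin 3, i ≠ j → slotSign L α w i ≠ slotSign L α w j → x w i = x w j → c w i ≠ c w j}))) :
    ∃ U' ∈ 𝓝 x, BddAbove ((fun c => ‖iteratedFDeriv ℝ n (orbFamGExt L α ν' a' S') c‖) '' (U' ∩ InRegG (slotSign L α) S')) := by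
  obtain ⟨U₀, hU₀o, hxU₀, hU₀⟩ := exists_nhds_forall_mem_inRegG_iff_of_multiWall (slotSign L α) S' hlit
  -- the off-wall set and the open set where the model is read
  set Ω : Set ({w : InfinitePlace L // IsComplex w} → Fin 3 → ℝ) :=
    {c | ∀ w, w ∉ S' → ∀ i j : Fin 3, i ≠ j → slotSign L α w i ≠ slotSign L α w j → x w i = x w j → c w i ≠ c w j} with hΩ
  have hΩo : IsOpen Ω := isOpen_setOf_forall_multiWall_ne (slotSign L α) S' x
  set O : Set ({w : InfinitePlace L // IsComplex w} → Fin 3 → ℝ) := interior U ∩ U₀ ∩ Ω with hO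
  have hOo : IsOpen O := (isOpen_interior.inter hU₀o).inter hΩo
  have hOsub : O ⊆ U ∩ Ω := fun c hc => ⟨interior_subset hc.1.1, hc.2⟩
  -- the smooth unit `(e^ρ)⁻¹`
  have hf : ContDiff ℝ ∞ fun c : {w : InfinitePlace L // IsComplex w} → Fin 3 → ℝ => (archERhoG S' c)⁻¹ :=
    (contDiff_archERhoG S').inv fun c => archERhoG_ne_zero_of_fintype S' c
  have hb : ∀ k ≤ n, ∃ U' ∈ 𝓝 x, BddAbove ((fun c => ‖iteratedFDeriv ℝ k H c‖) '' (U' ∩ O)) := by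
    intro k hk
    obtain ⟨U', hU', hB⟩ := hHb k hk
    exact ⟨U', hU', hB.mono (image_mono fun c hc => show c ∈ U' ∩ Ω from ⟨hc.1, hc.2.2⟩)⟩
  obtain ⟨U₁, hU₁, hB⟩ := Literature.Analysis.Calculus.exists_nhds_bddAbove_norm_iteratedFDeriv_mul hf hOo (hHs.mono hOsub) hb
  -- on `O` the family IS `(e^ρ)⁻¹ · H`
  have hEq : ∀ c ∈ O, orbFamGExt L α ν' a' S' c = (archERhoG S' c)⁻¹ * H c := by
    intro c hc
    rw [← hfac c (hOsub hc).1 (hOsub hc).2, ← mul_assoc, inv_mul_cancel₀ (archERhoG_ne_zero_of_fintype S' c), one_mul]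
  have hxO' : interior U ∩ U₀ ∈ 𝓝 x := inter_mem (isOpen_interior.mem_nhds (mem_interior_iff_mem_nhds.2 hU)) (hU₀o.mem_nhds hxU₀)
  refine ⟨U₁ ∩ (interior U ∩ U₀), inter_mem hU₁ hxO', hB.mono ?_⟩
  rintro _ ⟨c, ⟨⟨hc₁, hcU, hcU₀⟩, hcreg⟩, rfl⟩
  have hcΩ : c ∈ Ω := ((hU₀ c hcU₀).1).1 hcreg
  have hcO : c ∈ O := ⟨⟨hcU, hcU₀⟩, hcΩ⟩
  refine ⟨c, ⟨hc₁, hcO⟩, ?_⟩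
  have hev : (fun c => (archERhoG S' c)⁻¹ * H c) =ᶠ[𝓝 c] orbFamGExt L α ν' a' S' :=
    Filter.eventuallyEq_of_mem (hOo.mem_nhds hcO) fun y hy => (hEq y hy).symm
  show ‖iteratedFDeriv ℝ n (fun y => (archERhoG S' y)⁻¹ * H y) c‖ = ‖iteratedFDeriv ℝ n (orbFamGExt L α ν' a' S') c‖
  rw [(hev.iteratedFDeriv ℝ n).eq_of_nhds]

/-- **The `∀ n` form at a multi-wall point**: with jets of ALL orders of the model bounded near `x` off the literal walls, every jet of `orbFamGExt ν′ a′ S′` is bounded near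
`x` on `InRegG`. [cite: Bouaziz1994IntegralesOrbitales, §3.1 (I₁) p. 579] [cite: Varadarajan1977, Part I §1.12] -/
theorem forall_exists_nhds_bddAbove_norm_iteratedFDeriv_orbFamGExt_of_multiWallModel {x : {w : InfinitePlace L // IsComplex w} → Fin 3 → ℝ}
    (hlit : ∀ w, w ∉ S' → ∀ i j : Fin 3, i ≠ j → slotSign L α w i ≠ slotSign L α w j → Circle.exp (x w i) = Circle.exp (x w j) → x w i = x w j)
    {U : Set ({w : InfinitePlace L // IsComplex w} → Fin 3 → ℝ)} (hU : U ∈ 𝓝 x) (H : ({w : InfinitePlace L // IsComplex w} → Fin 3 → ℝ) → ℂ)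
    (hfac : ∀ c ∈ U, (∀ w, w ∉ S' → ∀ i j : Fin 3, i ≠ j → slotSign L α w i ≠ slotSign L α w j → x w i = x w j → c w i ≠ c w j) →
      archERhoG S' c * orbFamGExt L α ν' a' S' c = H c)
    (hHs : ContDiffOn ℝ ∞ H (U ∩ {c | ∀ w, w ∉ S' → ∀ i j : Fin 3, i ≠ j → slotSign L α w i ≠ slotSign L α w j → x w i = x w j → c w i ≠ c w j}))
    (hHb : ∀ k : ℕ, ∃ U' ∈ 𝓝 x, BddAbove ((fun c => ‖iteratedFDeriv ℝ k H c‖) ''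
      (U' ∩ {c | ∀ w, w ∉ S' → ∀ i j : Fin 3, i ≠ j → slotSign L α w i ≠ slotSign L α w j → x w i = x w j → c w i ≠ c w j}))) (n : ℕ) :
    ∃ U' ∈ 𝓝 x, BddAbove ((fun c => ‖iteratedFDeriv ℝ n (orbFamGExt L α ν' a' S') c‖) '' (U' ∩ InRegG (slotSign L α) S')) :=
  exists_nhds_bddAbove_norm_iteratedFDeriv_orbFamGExt_of_multiWallModel L α ν' a' S' hlit hU H hfac n (hHs.of_le (mod_cast le_top)) fun k _ => hHb k

/-! ## §3 The product-coordinate reading: the model is a pull-back `H₂ ∘ A` along a continuous linear chart -/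

/-- **(I₁) AT A MULTI-WALL POINT, PRODUCT-COORDINATE FORM.**  Same as `exists_nhds_bddAbove_norm_iteratedFDeriv_orbFamGExt_of_multiWallModel`, with the model read in PRODUCT
COORDINATES: off the literal walls near `x` the twisted family equals `H₂ (A c)` for a continuous linear chart `A : V →L P` (e.g. `A c = (π c, ν₁ c, ν₂ c)`: transversal
coordinates × the two normal coordinates of a cross-place corner) and a model `H₂` of class `Cⁿ` with bounded jets of order `≤ n` on an OPEN set `O₂ ⊆ P` containing the
images of the off-wall points of `U` (e.g. `Q ×ˢ {ψ₁ ≠ 0} ×ˢ {ψ₂ ≠ 0}`, the doubly punctured product box of (X3)).  The pull-back costs the factor `‖A‖ᵏ` (★ (B2) §1).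
[cite: Varadarajan1977, Part I §1.12] [cite: Bouaziz1994IntegralesOrbitales, §3.1 (I₁)–(I₂) p. 579] [cite: HormanderALPDO1, §1.1 (1.1.8)] -/
theorem exists_nhds_bddAbove_norm_iteratedFDeriv_orbFamGExt_of_multiWallProductModel {x : {w : InfinitePlace L // IsComplex w} → Fin 3 → ℝ}
    (hlit : ∀ w, w ∉ S' → ∀ i j : Fin 3, i ≠ j → slotSign L α w i ≠ slotSign L α w j → Circle.exp (x w i) = Circle.exp (x w j) → x w i = x w j)
    {P : Type*} [NormedAddCommGroup P] [NormedSpace ℝ P] (A : ({w : InfinitePlace L // IsComplex w} → Fin 3 → ℝ) →L[ℝ] P) (H₂ : P → ℂ)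
    {U : Set ({w : InfinitePlace L // IsComplex w} → Fin 3 → ℝ)} (hU : U ∈ 𝓝 x)
    (hfac : ∀ c ∈ U, (∀ w, w ∉ S' → ∀ i j : Fin 3, i ≠ j → slotSign L α w i ≠ slotSign L α w j → x w i = x w j → c w i ≠ c w j) →
      archERhoG S' c * orbFamGExt L α ν' a' S' c = H₂ (A c))
    {O₂ : Set P} (hO₂ : IsOpen O₂)
    (hAO : ∀ c ∈ U, (∀ w, w ∉ S' → ∀ i j : Fin 3, i ≠ j → slotSign L α w i ≠ slotSign L α w j → x w i = x w j → c w i ≠ c w j) → A c ∈ O₂)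
    (n : ℕ) (hH₂s : ContDiffOn ℝ n H₂ O₂) (hH₂b : ∀ k ≤ n, BddAbove ((fun y => ‖iteratedFDeriv ℝ k H₂ y‖) '' O₂)) :
    ∃ U' ∈ 𝓝 x, BddAbove ((fun c => ‖iteratedFDeriv ℝ n (orbFamGExt L α ν' a' S') c‖) '' (U' ∩ InRegG (slotSign L α) S')) := by
  have hmaps : MapsTo A (U ∩ {c | ∀ w, w ∉ S' → ∀ i j : Fin 3, i ≠ j → slotSign L α w i ≠ slotSign L α w j → x w i = x w j → c w i ≠ c w j}) O₂ :=
    fun c hc => hAO c hc.1 hc.2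
  refine exists_nhds_bddAbove_norm_iteratedFDeriv_orbFamGExt_of_multiWallModel L α ν' a' S' hlit hU (H₂ ∘ A) (fun c hc hcw => hfac c hc hcw) n
    (hH₂s.comp A.contDiff.contDiffOn hmaps) fun k hk => ⟨U, hU, ?_⟩
  exact Literature.Analysis.Calculus.bddAbove_norm_iteratedFDeriv_comp_clm_image A hO₂ (hH₂s.of_le (mod_cast hk)) hmaps
    ((hH₂b k hk).mono (image_mono (mapsTo_iff_image_subset.1 hmaps)))

/-- **The `∀ n` product-coordinate form at a multi-wall point** (model `C^∞` on `O₂` with all jets bounded there).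
[cite: Bouaziz1994IntegralesOrbitales, §3.1 (I₁) p. 579] [cite: HormanderALPDO1, §1.1 (1.1.8)] -/
theorem forall_exists_nhds_bddAbove_norm_iteratedFDeriv_orbFamGExt_of_multiWallProductModel {x : {w : InfinitePlace L // IsComplex w} → Fin 3 → ℝ}
    (hlit : ∀ w, w ∉ S' → ∀ i j : Fin 3, i ≠ j → slotSign L α w i ≠ slotSign L α w j → Circle.exp (x w i) = Circle.exp (x w j) → x w i = x w j)
    {P : Type*} [NormedAddCommGroup P] [NormedSpace ℝ P] (A : ({w : InfinitePlace L // IsComplex w} → Fin 3 → ℝ) →L[ℝ] P) (H₂ : P → ℂ)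
    {U : Set ({w : InfinitePlace L // IsComplex w} → Fin 3 → ℝ)} (hU : U ∈ 𝓝 x)
    (hfac : ∀ c ∈ U, (∀ w, w ∉ S' → ∀ i j : Fin 3, i ≠ j → slotSign L α w i ≠ slotSign L α w j → x w i = x w j → c w i ≠ c w j) →
      archERhoG S' c * orbFamGExt L α ν' a' S' c = H₂ (A c))
    {O₂ : Set P} (hO₂ : IsOpen O₂)
    (hAO : ∀ c ∈ U, (∀ w, w ∉ S' → ∀ i j : Fin 3, i ≠ j → slotSign L α w i ≠ slotSign L α w j → x w i = x w j → c w i ≠ c w j) → A c ∈ O₂)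
    (hH₂s : ContDiffOn ℝ ∞ H₂ O₂) (hH₂b : ∀ k : ℕ, BddAbove ((fun y => ‖iteratedFDeriv ℝ k H₂ y‖) '' O₂)) (n : ℕ) :
    ∃ U' ∈ 𝓝 x, BddAbove ((fun c => ‖iteratedFDeriv ℝ n (orbFamGExt L α ν' a' S') c‖) '' (U' ∩ InRegG (slotSign L α) S')) :=
  exists_nhds_bddAbove_norm_iteratedFDeriv_orbFamGExt_of_multiWallProductModel L α ν' a' S' hlit A H₂ hU hfac hO₂ hAO n (hH₂s.of_le (mod_cast le_top))
    fun k _ => hH₂b k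

/-! ## §4 Socket adapters for the (X′) stratum of ★ `wall_point_trichotomy` (cube hypothesis ⇒ literal walls) -/

/-- **(I₁) AT A WALL POINT OF THE FUNDAMENTAL CUBE, BINDER FORM** — the `hwall` callback of ★ `smoothBounded_orbFamGExt_of_forall_wall` at a cube point `x` (`x w i ∈ [0, 2π)`
at the compact places, so every coincidence is literal) from a `Cⁿ` model of the twisted family off the literal walls with bounded jets; in particular the (X′) socket `hX` of
★ `smoothBounded_orbFamGExt_of_strata` once (X2)+(X3) supply the model at the cross-place corners. [cite: Bouaziz1994IntegralesOrbitales, §3.1 (I₁) p. 579; §3.2 p. 580]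
[cite: Shelstad1979, §4 pp. 22–24] [cite: Varadarajan1977, Part I §1.12] -/
theorem exists_nhds_bddAbove_norm_iteratedFDeriv_orbFamGExt_of_multiWallModel_cube {x : {w : InfinitePlace L // IsComplex w} → Fin 3 → ℝ}
    (hcube : ∀ w, w ∉ S' → ∀ i : Fin 3, x w i ∈ Ico 0 (2 * Real.pi))
    {U : Set ({w : InfinitePlace L // IsComplex w} → Fin 3 → ℝ)} (hU : U ∈ 𝓝 x) (H : ({w : InfinitePlace L // IsComplex w} → Fin 3 → ℝ) → ℂ)
    (hfac : ∀ c ∈ U, (∀ w, w ∉ S' → ∀ i j : Fin 3, i ≠ j → slotSign L α w i ≠ slotSign L α w j → x w i = x w j → c w i ≠ c w j) →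
      archERhoG S' c * orbFamGExt L α ν' a' S' c = H c)
    (n : ℕ) (hHs : ContDiffOn ℝ n H (U ∩ {c | ∀ w, w ∉ S' → ∀ i j : Fin 3, i ≠ j → slotSign L α w i ≠ slotSign L α w j → x w i = x w j → c w i ≠ c w j}))
    (hHb : ∀ k ≤ n, ∃ U' ∈ 𝓝 x, BddAbove ((fun c => ‖iteratedFDeriv ℝ k H c‖) ''
      (U' ∩ {c | ∀ w, w ∉ S' → ∀ i j : Fin 3, i ≠ j → slotSign L α w i ≠ slotSign L α w j → x w i = x w j → c w i ≠ c w j}))) :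
    ∃ U' ∈ 𝓝 x, BddAbove ((fun c => ‖iteratedFDeriv ℝ n (orbFamGExt L α ν' a' S') c‖) '' (U' ∩ InRegG (slotSign L α) S')) :=
  exists_nhds_bddAbove_norm_iteratedFDeriv_orbFamGExt_of_multiWallModel L α ν' a' S' (forall_literal_of_cube (slotSign L α) S' hcube) hU H hfac n hHs hHb

end Head

end Literature.NumberTheory.Rogawski1990

end
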